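import Mathlib
import HarnessLib
import Summits.NavierStokesRegularity.NavierStokesRegularity.Theses.AxisTwistDoor
import Summits.NavierStokesRegularity.NavierStokesRegularity.Theorems.AxisTwistDoorAveragedConeLiouvilleOfLeiRen
import Summits.NavierStokesRegularity.NavierStokesRegularity.Theorems.AxisTwistDoorAveragedConeLiouvilleHolds
import Summits.NavierStokesRegularity.NavierStokesRegularity.Theorems.FilamentPinchDoorFilamentaryGrowth
import Summits.NavierStokesRegularity.NavierStokesRegularity.Theorems.AxisTwistDoorScalingToUnit
import Summits.NavierStokesRegularity.NavierStokesRegularity.Theorems.AxisTwistDoorRotationToAxis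

/-!
# Route `AxisTwistDoor` (rung N0-LocalTubeDoorHalfSpace, leaf `HalfSpaceWindowDoor.Target`) — KERNEL STATUS, 2026-08-28

One theorem recording, in the kernel, what the route still owes after the work of 2026-08-28 (items 26432, 26431,
26890, 26992 CLOSED; crux 26889 `AveragedConeLiouville` proved GIVEN Lei–Ren 2024 by `averagedConeLiouville_of_leiRen`,
the classical positivity propagation having been proved in the tree; research crux 26991 `TiltDominationLoc` OPEN):

* `target_of_leiRen_of_tiltDominationLoc` — the leaf `HalfSpaceWindowDoor.Target` follows from EXACTLY two open
  inputs: the typed literature fact `Literature.Analysis.FluidPDE.LeiRen2024_quantitative_regular_shells_cyl` (Lei–Ren,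
  Adv. Math. 445 (2024) 109654 = Lei–Ren–Tian arXiv:2501.08976 Lemma 2.4; cite item wi-87109; not proved in the tree)
  and the route's research crux `TiltDominationLoc` (stmt-NavierStokesRegularity-26991, XL).  It is the planner's
  deciding theorem `Theses.AxisTwistDoor.closes` with every other hypothesis instantiated by its landed proof:
  `SuitableHalfSpaceZoom_holds` (26432), `axisTwistDoor_filamentaryGrowth_proof` (26431),
  `averagedConeLiouville_of_leiRen` (26889, conditional), `scalingToUnit_proof` (26992), `rotationToAxis_proof` (26890).

HONEST STATUS: a CONDITIONAL statement (two hypotheses, one of them an open research crux); it proves neither the leaf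
nor any Navier–Stokes regularity statement (Clay A OPEN).  Seat ns-atd-p1 (LEAD g2).
-/

noncomputable section

set_option linter.dupNamespace false

namespace Summit.NavierStokesRegularity.NavierStokesRegularity.Theorems.AxisTwistDoorStatus

open Summit.NavierStokesRegularity.NavierStokesRegularity.Theses.AxisTwistDoor

/-- **What the route `AxisTwistDoor` still owes, in one line**: the leaf `HalfSpaceWindowDoor.Target` GIVEN Lei–Ren's
quantitative regular shells and the research crux `TiltDominationLoc`; all other items of the deciding theorem
`closes` are instantiated by their landed proofs. [conditional on: `LeiRen2024_quantitative_regular_shells_cyl`,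
`TiltDominationLoc`] -/
theorem target_of_leiRen_of_tiltDominationLoc
    (hL : Literature.Analysis.FluidPDE.LeiRen2024_quantitative_regular_shells_cyl)
    (hT : TiltDominationLoc) :
    Summit.NavierStokesRegularity.NavierStokesRegularity.Theses.HalfSpaceWindowDoor.Target :=
  closes SuitableHalfSpaceZoom_holds
    Summit.NavierStokesRegularity.NavierStokesRegularity.Theorems.axisTwistDoor_filamentaryGrowth_proof hT
    (Summit.NavierStokesRegularity.NavierStokesRegularity.Theorems.AxisTwistDoorAveragedConeLiouvilleOfLeiRen.averagedConeLiouville_of_leiRen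
      hL)
    Summit.NavierStokesRegularity.NavierStokesRegularity.Theorems.AxisTwistDoorScalingToUnit.scalingToUnit_proof
    Summit.NavierStokesRegularity.NavierStokesRegularity.Theorems.AxisTwistDoorRotationToAxis.rotationToAxis_proof

/-- **What the route `AxisTwistDoor` still owes after the crux `AveragedConeLiouville` closed (2026-08-28T14:00Z)**:
the leaf `HalfSpaceWindowDoor.Target` GIVEN ONLY the research crux `TiltDominationLoc`
(stmt-NavierStokesRegularity-26991); every other argument of the deciding theorem `closes` is a landed proof
(`averagedConeLiouville_holds` p639289, `scalingToUnit_proof`, `rotationToAxis_proof`, `axisTwistDoor_filamentaryGrowth_proof`,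
`SuitableHalfSpaceZoom_holds`). [conditional on: `TiltDominationLoc`] -/
theorem target_of_tiltDominationLoc (hT : TiltDominationLoc) :
    Summit.NavierStokesRegularity.NavierStokesRegularity.Theses.HalfSpaceWindowDoor.Target :=
  closes SuitableHalfSpaceZoom_holds
    Summit.NavierStokesRegularity.NavierStokesRegularity.Theorems.axisTwistDoor_filamentaryGrowth_proof hT
    Summit.NavierStokesRegularity.NavierStokesRegularity.Theorems.AxisTwistDoorAveragedConeLiouvilleHolds.averagedConeLiouville_holds
    Summit.NavierStokesRegularity.NavierStokesRegularity.Theorems.AxisTwistDoorScalingToUnit.scalingToUnit_proof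
    Summit.NavierStokesRegularity.NavierStokesRegularity.Theorems.AxisTwistDoorRotationToAxis.rotationToAxis_proof

end Summit.NavierStokesRegularity.NavierStokesRegularity.Theorems.AxisTwistDoorStatus

end
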